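import Summits.QuantumFields.YangMills.Theorems.BalabanLadderUVSeamRecCarrierCubePlaquettes
import Summits.QuantumFields.YangMills.Theorems.WeakCouplingRatesBulkDominatesColdBoxWKernelCongrCollar
import HarnessLib

/-!
# Crux `UVSeamRec` (stmt-QuantumFields-20043), line `coldwall_pure`: the classical response and its carrier are COLLAR-LOCAL functionals of the
# exterior, and vanish on exteriors that are flat around the cube

Helper file (`--supports stmt-QuantumFields-20043`) of seat `ymfull-r2d-prover-3` (hand on stub :130 `stub_classicalMomentsFemtoTail`), companion of
the typed obstruction memo `OBSTRUCTION-20043-130-g0.md`.  Kernel-checked structural facts about the OBJECT of the two measure-side tail stubs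
(`carrierCl r C s β R q x η = (βR⁴/C)·classicalResponse_{cube of radius R+1 around x}(q, x; s; η)`), every compact `G`:

* §1 `plane_congr_of_edges` — the single-plane field at `(x, q)` reads only the four edges of that plaquette;
* §2 `tiltedAction_congr_collar`, `tiltedMin_congr_collar`, `classicalResponse_congr_collar`, `carrierCl_congr_collar` — the tilted cube energies, the
  classical response and the carrier read the exterior `η` ONLY on the COLLAR: the edges, outside the cube, of the plaquettes touching the cube.  So each
  `carrierCl … (q i) (x i)` of a separated family is measurable with respect to a bounded neighbourhood of its own cube (metric form
  `carrierCl_congr_of_near`: agreement on all edges based within sup-distance `R + 2` of `x` suffices) — the starting point of any decoupling argument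
  for the joint exponential moments of :130 (memo §3 (DEC));
* §3 `carrierCl_eq_zero_of_wilsonBoundaryAction_eq_zero` — an exterior whose plaquettes touching the cube are all FLAT has zero carrier (its own
  restriction is a zero-energy extension): torons ∕ flat exteriors are invisible to both tail stubs (memo §2 (W3)).

HONEST FRAMING: bookkeeping on definitions; nothing of E0′, NT or a gap; finite-volume ∕ conditional; the Yang–Mills mass gap is NOT proved; not Clay.

References: Seiler, LNP 159 (1982) Ch. 2 (DLR kernels of the Wilson action read the collar); Georgii (2011) §1.2 (gluing).
-/

noncomputable section

open MeasureTheory Finset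
open Literature.MathematicalPhysics.QuantumFieldTheory (LatticeRep)
open Literature.MathematicalPhysics.QuantumLattice (LGConfig ZdPlaquette ZdEdge plaquettesTouching plaquetteEdges mem_plaquettesTouching_iff
  wilsonBoundaryAction plaquetteObs plaquetteHolonomyZd)
open Literature.Probability.LatticeModels (glueWith glueWith_apply_mem glueWith_apply_not_mem)
open Summit.QuantumFields.YangMills.Cruxes.OSLegsFromFemtoAndGap.DlrCollarTransfer
open Summit.QuantumFields.YangMills.Cruxes.UVSeamRec.BoundaryLawPenetration (mem_plaquettesTouching_cubeEdges)
open Summit.QuantumFields.YangMills.Cruxes.NT.BoundaryLaw (plane_eq_plaquetteObs)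
open Summit.QuantumFields.YangMills.Theorems.WeakCouplingRates (wilsonBoundaryAction_congr)

namespace Summit.QuantumFields.YangMills.Cruxes.UVSeamRec.ClassicalResponse

variable {G : Type} [Group G] [TopologicalSpace G] [IsTopologicalGroup G] [CompactSpace G]
  [MeasurableSpace G] [BorelSpace G] (r : LatticeRep G)

/-! ### §1 The single-plane field reads only its plaquette's edges -/

omit [IsTopologicalGroup G] [CompactSpace G] [BorelSpace G] in
/-- The single-plane field `plane q x` (`q.1 < q.2`) takes the same value on two configurations agreeing on the four edges of the plaquette
`(x, q)`. [folklore] -/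
theorem plane_congr_of_edges (q : Fin 4 × Fin 4) (hq : q.1 < q.2) (x : Fin 4 → ℤ) {U U' : LGConfig 4 G}
    (h : ∀ e ∈ plaquetteEdges ((x, ⟨q, hq⟩) : ZdPlaquette 4), U e = U' e) :
    plane G r q x U = plane G r q x U' := by
  rw [plane_eq_plaquetteObs, plane_eq_plaquetteObs]
  have h1 := h (x, q.1) (by simp [plaquetteEdges])
  have h2 := h (x + Pi.single q.1 1, q.2) (by simp [plaquetteEdges])
  have h3 := h (x + Pi.single q.2 1, q.1) (by simp [plaquetteEdges])
  have h4 := h (x, q.2) (by simp [plaquetteEdges])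
  simp only [plaquetteObs, plaquetteHolonomyZd, h1, h2, h3, h4]

/-! ### §2 Collar locality of the tilted energies, the classical response and the carrier -/

omit [Group G] [TopologicalSpace G] [IsTopologicalGroup G] [CompactSpace G] [MeasurableSpace G] [BorelSpace G] in
/-- Gluing the same interior into two exteriors that agree on the collar gives configurations agreeing on every edge of every plaquette touching
the cube. [folklore] -/
theorem glueWith_congr_collar (c : Fin 4 → ℤ) (b : ℕ) {η η' : LGConfig 4 G}
    (hη : ∀ p ∈ plaquettesTouching (cubeEdges c b), ∀ e ∈ plaquetteEdges p, e ∉ cubeEdges c b → η e = η' e)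
    (ζ : ↥(cubeEdges c b) → G) :
    ∀ p ∈ plaquettesTouching (cubeEdges c b), ∀ e ∈ plaquetteEdges p,
      glueWith (cubeEdges c b) ζ η e = glueWith (cubeEdges c b) ζ η' e := by
  intro p hp e he
  by_cases heΛ : e ∈ cubeEdges c b
  · rw [glueWith_apply_mem _ _ _ heΛ, glueWith_apply_mem _ _ _ heΛ]
  · rw [glueWith_apply_not_mem _ _ _ heΛ, glueWith_apply_not_mem _ _ _ heΛ, hη p hp e he heΛ]

omit [IsTopologicalGroup G] [CompactSpace G] [BorelSpace G] in
/-- **The tilted cube functional reads the exterior only on the collar** (depth of the tilted plaquette `≥ 2`, `q.1 < q.2`). [folklore] -/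
theorem tiltedAction_congr_collar {c : Fin 4 → ℤ} {b : ℕ} {x : Fin 4 → ℤ} (q : Fin 4 × Fin 4) (hq : q.1 < q.2) (hx : 2 ≤ depth c b x)
    (s : ℝ) {η η' : LGConfig 4 G}
    (hη : ∀ p ∈ plaquettesTouching (cubeEdges c b), ∀ e ∈ plaquetteEdges p, e ∉ cubeEdges c b → η e = η' e)
    (ζ : ↥(cubeEdges c b) → G) :
    tiltedAction r c b q x s η ζ = tiltedAction r c b q x s η' ζ := by
  have hg := glueWith_congr_collar c b hη ζ
  unfold tiltedAction
  rw [wilsonBoundaryAction_congr r.ρ (cubeEdges c b) hg,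
    plane_congr_of_edges r q hq x (hg _ (mem_plaquettesTouching_cubeEdges hx ⟨q, hq⟩))]

omit [IsTopologicalGroup G] [CompactSpace G] [BorelSpace G] in
/-- **The tilted minimum reads the exterior only on the collar.** [folklore] -/
theorem tiltedMin_congr_collar {c : Fin 4 → ℤ} {b : ℕ} {x : Fin 4 → ℤ} (q : Fin 4 × Fin 4) (hq : q.1 < q.2) (hx : 2 ≤ depth c b x)
    (s : ℝ) {η η' : LGConfig 4 G}
    (hη : ∀ p ∈ plaquettesTouching (cubeEdges c b), ∀ e ∈ plaquetteEdges p, e ∉ cubeEdges c b → η e = η' e) :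
    tiltedMin r c b q x s η = tiltedMin r c b q x s η' := by
  have h : tiltedAction r c b q x s η = tiltedAction r c b q x s η' :=
    funext (tiltedAction_congr_collar r q hq hx s hη)
  unfold tiltedMin
  rw [h]

omit [IsTopologicalGroup G] [CompactSpace G] [BorelSpace G] in
/-- **The classical response reads the exterior only on the collar.** [folklore] -/
theorem classicalResponse_congr_collar {c : Fin 4 → ℤ} {b : ℕ} {x : Fin 4 → ℤ} (q : Fin 4 × Fin 4) (hq : q.1 < q.2)
    (hx : 2 ≤ depth c b x) (s : ℝ) {η η' : LGConfig 4 G}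
    (hη : ∀ p ∈ plaquettesTouching (cubeEdges c b), ∀ e ∈ plaquetteEdges p, e ∉ cubeEdges c b → η e = η' e) :
    classicalResponse r c b q x s η = classicalResponse r c b q x s η' := by
  unfold classicalResponse
  rw [tiltedMin_congr_collar r q hq hx 0 hη, tiltedMin_congr_collar r q hq hx s hη]

omit [IsTopologicalGroup G] [CompactSpace G] [BorelSpace G] in
/-- **The classical carrier of the centred cube reads the exterior only on the collar** of the cube of side `2R+3` centred at `x`. [folklore] -/
theorem carrierCl_congr_collar (C s β : ℝ) (R : ℕ) (q : Fin 4 × Fin 4) (hq : q.1 < q.2) (x : Fin 4 → ℤ) {η η' : LGConfig 4 G}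
    (hη : ∀ p ∈ plaquettesTouching (cubeEdges (fun k => x k - (R + 1)) (2 * R + 3)), ∀ e ∈ plaquetteEdges p,
      e ∉ cubeEdges (fun k => x k - (R + 1)) (2 * R + 3) → η e = η' e) :
    carrierCl r C s β R q x η = carrierCl r C s β R q x η' := by
  unfold carrierCl
  rw [classicalResponse_congr_collar r q hq (by rw [depth_centred]; omega) s hη]

omit [TopologicalSpace G] [IsTopologicalGroup G] [CompactSpace G] [MeasurableSpace G] [BorelSpace G] in
/-- Edges of the plaquettes touching the centred cube of side `2R+3` are based within sup-distance `R + 2` of the centre. [folklore] -/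
theorem near_of_mem_plaquetteEdges_of_touching_centred {x : Fin 4 → ℤ} {R : ℕ} {p : ZdPlaquette 4}
    (hp : p ∈ plaquettesTouching (cubeEdges (fun k => x k - (R + 1)) (2 * R + 3))) {e : ZdEdge 4} (he : e ∈ plaquetteEdges p)
    (k : Fin 4) : |e.1 k - x k| ≤ (R : ℤ) + 2 := by
  have hb := base_sub_mem_of_mem_plaquettesTouching_centred hp k
  have hstep : ∀ i : Fin 4, 0 ≤ (Pi.single i (1 : ℤ) : Fin 4 → ℤ) k ∧ (Pi.single i (1 : ℤ) : Fin 4 → ℤ) k ≤ 1 := by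
    intro i
    by_cases hik : k = i
    · subst hik; simp
    · simp [hik]
  simp only [plaquetteEdges, mem_insert, mem_singleton] at he
  rw [abs_le]
  rcases he with rfl | rfl | rfl | rfl
  · constructor <;> linarith [hb.1, hb.2]
  · have h1 := hstep p.2.1.1
    simp only [Pi.add_apply]
    constructor <;> linarith [hb.1, hb.2, h1.1, h1.2]
  · have h1 := hstep p.2.1.2
    simp only [Pi.add_apply]
    constructor <;> linarith [hb.1, hb.2, h1.1, h1.2]
  · constructor <;> linarith [hb.1, hb.2]

omit [IsTopologicalGroup G] [CompactSpace G] [BorelSpace G] in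
/-- **Metric locality of the carrier**: two exteriors agreeing on every edge based within sup-distance `R + 2` of `x` have the same classical carrier
at `(R, q, x)`.  For a cyclically `2R+4`-separated family the neighbourhoods `{y : |y − x_i|_∞ ≤ R+2}` of distinct members can only meet in their
boundaries, which is the geometric input of any decoupling of the joint exponential moments of stub :130. [folklore] -/
theorem carrierCl_congr_of_near (C s β : ℝ) (R : ℕ) (q : Fin 4 × Fin 4) (hq : q.1 < q.2) (x : Fin 4 → ℤ) {η η' : LGConfig 4 G}
    (hη : ∀ e : ZdEdge 4, (∀ k : Fin 4, |e.1 k - x k| ≤ (R : ℤ) + 2) → η e = η' e) :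
    carrierCl r C s β R q x η = carrierCl r C s β R q x η' :=
  carrierCl_congr_collar r C s β R q hq x fun _ hp e he _ =>
    hη e (near_of_mem_plaquetteEdges_of_touching_centred hp he)

/-! ### §3 Flat collars are invisible -/

omit [BorelSpace G] in
/-- **An exterior that is flat around the cube has zero carrier**: if every plaquette touching the centred cube has zero deficit in `η`
(`S_cube(η) = 0`; e.g. `η` flat, a toron, or any configuration flat on the `(R+2)`-neighbourhood of `x`), then `carrierCl r C 1 β R q x η = 0`
for `C > 0`, `β ≥ 0` (the exterior's own restriction is a zero-energy extension, `carrierCl_le_mul_wilsonBoundaryAction`). [folklore] -/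
theorem carrierCl_eq_zero_of_wilsonBoundaryAction_eq_zero {C β : ℝ} (hC : 0 < C) (hβ : 0 ≤ β) (R : ℕ) (q : Fin 4 × Fin 4)
    (hq : q.1 < q.2) (x : Fin 4 → ℤ) {η : LGConfig 4 G}
    (h0 : wilsonBoundaryAction r.ρ (cubeEdges (fun k => x k - (R + 1)) (2 * R + 3)) η = 0) :
    carrierCl r C 1 β R q x η = 0 := by
  refine le_antisymm ?_ (carrierCl_nonneg hC one_pos hβ R q x η)
  have h := carrierCl_le_mul_wilsonBoundaryAction r hC hβ R q hq x η
  rw [h0, mul_zero] at h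
  exact h

omit [BorelSpace G] in
/-- In particular the IDENTITY exterior has zero carrier at every scale (also a consequence of `classicalResponse_one`). [folklore] -/
theorem carrierCl_one_exterior {C β : ℝ} (hC : 0 < C) (hβ : 0 ≤ β) (R : ℕ) (q : Fin 4 × Fin 4) (hq : q.1 < q.2) (x : Fin 4 → ℤ) :
    carrierCl r C 1 β R q x (1 : LGConfig 4 G) = 0 :=
  carrierCl_eq_zero_of_wilsonBoundaryAction_eq_zero r hC hβ R q hq x (Summit.QuantumFields.YangMills.Cruxes.UVSeamRec.BoundaryLawPenetration.wilsonBoundaryAction_one r _)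

end Summit.QuantumFields.YangMills.Cruxes.UVSeamRec.ClassicalResponse

end
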